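import Summits.QuantumFields.YangMills.Theorems.IR.VolumeMonotoneWindowRung
import HarnessLib

/-!
# Crux `IR` (stmt-QuantumFields-19354), line `ym-ir7-volume-monotone-gap` (ideator ym-ir-idea-7) — part 4:
# the rung MONO-sc on ALL of `(0, β_D]`, PROVED (`volumeMonotoneStrongCoupling_holds : VolumeMonotoneStrongCoupling`)

Helper module for item `stmt-QuantumFields-19354` (`--supports … --as helper`; it closes no item — `IR` stays open).  Pooled prover
ym-ir-line-pool-p3 (g5).  The skeleton's v5 «RUNG CORRECTION» priced the `(0, β_D]`-uniform rung MONO-sc (`VolumeMonotoneStrongCoupling`: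
ONE rate-retention factor `θ` and ONE volume floor `S₀` for every `β ∈ (0, β_D]`) as needing two inputs absent from the tree: (a) a
RATE-TRACKING strong-coupling cold-pressure bound (rate `≍ log(1/β)`) and (b) the β-explicit transfer-gap CEILING `m(β,S) ≤ 4 log(1/β) + c′`
uniformly in `S`.  Both are now theorems: (a) `coldPressureBound_strongCoupling_log` (`Theorems/IR/StrongCouplingRateColdPressure.lean`,
pool-p3 g2) and (b) `traceExcess_floor_strongCoupling` (part 2b).  This file removes the last obstruction — (b)'s volume floor
`S₀(β₁) ≍ 16 log(1/β₁)` came from bounding the two thermal corrections with the β-INDEPENDENT rate `1/8`; with the rate-tracking bound the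
corrections are `≤ C e^{−S/4} (β/r_ρ)^{S/4} ≤ C e^{−S/4} β⁴/r_ρ⁴` for `S ≥ 16`, i.e. below `c β⁴/(8p²)` for `S ≥ S₀` with `S₀` FREE OF `β` — and proves:

* `coldTraceBound_strongCoupling_log` — the rate-tracking bound in the (stronger) `ColdTraceBound` form (no `(2S+1)³` prefactor):
  `traceExcess r.ρ β (2S+1) (m+2) ≤ C_st e^{−(1+log(r_ρ/β))(m+2)/8}` on the cold range, every torus, `0 < β ≤ r_ρ`;
* `traceExcess_floor_strongCoupling_uniform` — **T-GAP-FINITE-sc with a β-uniform volume floor**: `∃ βF c₁ S₀`, `∀ β ∈ (0, βF] ∀ S ≥ S₀ ∀ m`,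
  `(c₁β⁴)^{m+2} ≤ traceExcess r.ρ β (2S+1) (m+2)`;
* `traceExcess_twoSided_strongCoupling` (§4) — the two-sided, volume-uniform SC glueball window in one statement:
  `(c₁β⁴)^{m+2} ≤ traceExcess ≤ C_st e^{−(1+log(r_ρ/β))(m+2)/8}` on the cold range (citeable corollary for the census C-rows);
* `volumeMonotoneStrongCoupling_holds : VolumeMonotoneStrongCoupling` — **the rung MONO-sc AS TYPED** (tree constant of
  `Theorems/IR/VolumeMonotoneDefs.lean`, VERBATIM the skeleton's `stub_rung_monoStrongCoupling`): `β_D := min βF (2c₁)^{-1/4}`,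
  `θ := min(1/D, 1/4)/8` with `D = log(1/(c₁β_D⁴)) ≥ log 2`, `K := max 1 C_st`: a cold trace bound at size `S ≥ S₀` with rate `g` and
  `1 ≤ C₀` has `g ≤ log(1/(c₁β⁴)) = 4 log(β_D/β) + D` (seam `rate_le_of_traceExcessFloor`), and `θ·(4u + D) ≤ (1+u)/8 ≤ (1+log(r_ρ/β))/8`
  (`u = log(β_D/β) ≥ 0`) is a rate the tree certifies on EVERY torus.

HONEST FRAMING: a FORMAT rung inside `IR`'s known (strong-coupling) regime — the BC5-type witness that the MONO format is decided TRUE where the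
cluster expansion converges (crit-1's standing rung rule; answers crit-2's P3 in `d = 4` as a theorem); it is NOT a witness of weakness and proves
nothing about `BalabanLadder.IR`, MONO beyond `β_D`, a weak-coupling lattice gap, or the Yang–Mills mass gap (Clay); R4 of the ladder closes
only the conditional finite-𝕋⁴ rung `BalabanLadder.UV`.
-/

set_option autoImplicit false

noncomputable section

open Filter Topology MeasureTheory
open Literature.MathematicalPhysics.QuantumFieldTheory Literature.MathematicalPhysics.QuantumLattice
open Literature.MathematicalPhysics.QuantumFieldTheory.Balaban1983to89.Sufficient (ColdPressureBound ColdTraceBound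
  coldPressureBound_of_coldTraceBound)
open Literature.MathematicalPhysics.QuantumFieldTheory.Balaban1983to89.Missing
open Summit.QuantumFields.YangMills.Cruxes.IR.StrongCouplingRate (coldTraceBound_strongCoupling_rate coldPressureBound_strongCoupling_log)

namespace Summit.QuantumFields.YangMills.Cruxes.IR.VolumeMonotone

variable {G : Type} [Group G] [TopologicalSpace G] [IsTopologicalGroup G] [CompactSpace G]
  [MeasurableSpace G] [BorelSpace G]

/-! ## §1 The rate-tracking strong-coupling bound in `ColdTraceBound` form -/

/-- **Rate-tracking cold trace bound** (input (a) without the `(2S+1)³` prefactor): for `0 < β ≤ r_ρ` and every spatial torus `(2S+1)³`,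
`traceExcess r.ρ β (2S+1) (m+2) ≤ C_st · e^{−((1 + log(r_ρ/β))/8)(m+2)}` on the cold range `S + 1 ≤ 2(m+2)`, `C_st = 28311552 e^{28311552}`. -/
theorem coldTraceBound_strongCoupling_log (r : LatticeRep G) {β : ℝ} (hβ0 : 0 < β)
    (hβ : β ≤ strongCouplingRadius r.ρ) (S : ℕ) :
    ColdTraceBound r.ρ β S ((1 + Real.log (strongCouplingRadius r.ρ / β)) / 8) (28311552 * Real.exp 28311552) := by
  haveI : SecondCountableTopology G :=
    (r.continuous.isClosedEmbedding r.injective).isEmbedding.secondCountableTopology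
  have hr0 := strongCouplingRadius_pos r.ρ
  have hM := costBound_pos r.ρ
  have hq : 1 ≤ strongCouplingRadius r.ρ / β := by rw [le_div_iff₀ hβ0, one_mul]; exact hβ
  have hτ : 1 ≤ 1 + Real.log (strongCouplingRadius r.ρ / β) := by
    have := Real.log_nonneg hq
    linarith
  have hβM : β * costBound r.ρ ≤ 1 :=
    le_trans (mul_le_mul_of_nonneg_right hβ hM.le) (strongCouplingRadius_mul_costBound_le_one r.ρ)
  have hexp : Real.exp (1 + (1 + Real.log (strongCouplingRadius r.ρ / β))) =
      Real.exp 2 * (strongCouplingRadius r.ρ / β) := by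
    rw [show (1 : ℝ) + (1 + Real.log (strongCouplingRadius r.ρ / β)) = 2 + Real.log (strongCouplingRadius r.ρ / β) by ring,
      Real.exp_add, Real.exp_log (lt_of_lt_of_le one_pos hq)]
  have hsmall : Real.exp (1 + (1 + Real.log (strongCouplingRadius r.ρ / β))) * (2 * costBound r.ρ * β) *
      ((boxDeg 4 : ℝ) + 1) ^ 2 ≤ 1 / 2 := by
    rw [hexp]
    have heq : Real.exp 2 * (strongCouplingRadius r.ρ / β) * (2 * costBound r.ρ * β) =
        Real.exp 2 * (2 * costBound r.ρ * strongCouplingRadius r.ρ) := by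
      field_simp
    rw [heq]
    exact strongCouplingRadius_smallness r.ρ
  exact coldTraceBound_strongCoupling_rate r hβ0.le hτ hβM hsmall S

/-- **The thermal corrections under the rate-tracking bound are `O(β⁴)` with a β-FREE volume threshold**: for `0 < β ≤ r_ρ`, `S ≥ 16` and
`m + 2 ≥ 2S`, `traceExcess r.ρ β (2S+1) (m+2) ≤ C_st e^{−S/4} β⁴ / r_ρ⁴`. -/
theorem traceExcess_thermal_le_pow_four (r : LatticeRep G) {β : ℝ} (hβ0 : 0 < β)
    (hβ : β ≤ strongCouplingRadius r.ρ) {S : ℕ} (hS : 16 ≤ S) {m : ℕ} (hm : 2 * S ≤ m + 2) :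
    traceExcess r.ρ β (2 * S + 1) (m + 2) ≤
      28311552 * Real.exp 28311552 * Real.exp (-((S : ℝ) / 4)) * (β ^ 4 / strongCouplingRadius r.ρ ^ 4) := by
  have hr0 := strongCouplingRadius_pos r.ρ
  set rr : ℝ := strongCouplingRadius r.ρ with hrr
  set L : ℝ := Real.log (rr / β) with hL
  have hq : 1 ≤ rr / β := by rw [le_div_iff₀ hβ0, one_mul]; exact hβ
  have hL0 : 0 ≤ L := Real.log_nonneg hq
  have h1 := coldTraceBound_strongCoupling_log r hβ0 hβ S m (by omega)
  refine h1.trans ?_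
  have hC : (0 : ℝ) ≤ 28311552 * Real.exp 28311552 := by positivity
  rw [mul_assoc (28311552 * Real.exp 28311552)]
  refine mul_le_mul_of_nonneg_left ?_ hC
  -- `e^{−(1+L)(m+2)/8} ≤ e^{−(1+L)·2S/8} = e^{−S/4} e^{−L S/4} ≤ e^{−S/4} e^{−4L} = e^{−S/4} (β/r_ρ)⁴`
  have hm' : (2 * S : ℝ) ≤ ((m + 2 : ℕ) : ℝ) := by exact_mod_cast hm
  have hS' : (16 : ℝ) ≤ (S : ℝ) := by exact_mod_cast hS
  have hstep1 : Real.exp (-((1 + L) / 8 * ((m + 2 : ℕ) : ℝ))) ≤ Real.exp (-((S : ℝ) / 4) + -(4 * L)) := by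
    refine Real.exp_le_exp.2 ?_
    have h2 : (1 + L) / 8 * (2 * S : ℝ) ≤ (1 + L) / 8 * ((m + 2 : ℕ) : ℝ) :=
      mul_le_mul_of_nonneg_left hm' (by positivity)
    have h3 : 4 * L ≤ L * (S : ℝ) / 4 := by nlinarith
    nlinarith
  refine hstep1.trans (le_of_eq ?_)
  have hlog : Real.log (β / rr) = -Real.log (rr / β) := by
    rw [← inv_div rr β, Real.log_inv]
  rw [Real.exp_add, hL, show -(4 * Real.log (rr / β)) = ((4 : ℕ) : ℝ) * Real.log (β / rr) by rw [hlog]; push_cast; ring,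
    Real.exp_nat_mul, Real.exp_log (div_pos hβ0 hr0), div_pow]

/-! ## §2 T-GAP-FINITE-sc with a β-uniform volume floor -/

/-- Exponential decay beats any threshold: `∃ S₀ ≥ 16, ∀ S ≥ S₀, A e^{−S/4} ≤ ε` (`A ≥ 0`, `ε > 0`). -/
theorem exists_floor_exp_quarter_le {A ε : ℝ} (hA : 0 ≤ A) (hε : 0 < ε) :
    ∃ S₀ : ℕ, 16 ≤ S₀ ∧ ∀ S : ℕ, S₀ ≤ S → A * Real.exp (-((S : ℝ) / 4)) ≤ ε := by
  refine ⟨⌈4 * Real.log (A / ε)⌉₊ + 16, by omega, fun S hS => ?_⟩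
  have hS' : 4 * Real.log (A / ε) ≤ (S : ℝ) := by
    have h1 : 4 * Real.log (A / ε) ≤ ((⌈4 * Real.log (A / ε)⌉₊ : ℕ) : ℝ) := Nat.le_ceil _
    have h2 : ((⌈4 * Real.log (A / ε)⌉₊ + 16 : ℕ) : ℝ) ≤ (S : ℝ) := by exact_mod_cast hS
    push_cast at h2
    linarith
  rcases eq_or_lt_of_le hA with hA' | hA'
  · rw [← hA', zero_mul]; exact hε.le
  · have h3 : Real.log (A / ε) ≤ (S : ℝ) / 4 := by linarith
    have h4 : A / ε ≤ Real.exp ((S : ℝ) / 4) := by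
      rw [← Real.log_le_iff_le_exp (div_pos hA' hε)]; exact h3
    rw [div_le_iff₀ hε] at h4
    have h6 : Real.exp ((S : ℝ) / 4) * Real.exp (-((S : ℝ) / 4)) = 1 := by
      rw [← Real.exp_add, add_neg_cancel, Real.exp_zero]
    calc A * Real.exp (-((S : ℝ) / 4)) ≤ (Real.exp ((S : ℝ) / 4) * ε) * Real.exp (-((S : ℝ) / 4)) :=
          mul_le_mul_of_nonneg_right h4 (Real.exp_nonneg _)
      _ = ε := by rw [mul_assoc, mul_comm ε, ← mul_assoc, h6, one_mul]

/-- **T-GAP-FINITE-sc with a β-UNIFORM volume floor.**  For every compact simple Lie group `G` and `r : LatticeRep G` there are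
`0 < βF ≤ strongCouplingRadius r.ρ`, `c₁ > 0` and ONE `S₀` with `(c₁β⁴)^{m+2} ≤ traceExcess r.ρ β (2S+1) (m+2)` for ALL `β ∈ (0, βF]`,
`S ≥ S₀`, `m` (part 2b's floor, with the thermal corrections bounded by the rate-tracking cold trace bound instead of the rate-`1/8` one). -/
theorem traceExcess_floor_strongCoupling_uniform :
    ∀ (G : Type) [Group G] [TopologicalSpace G] [IsTopologicalGroup G] [CompactSpace G],
      IsCompactSimpleLieGroup G →
      letI : MeasurableSpace G := borel G; haveI : BorelSpace G := ⟨rfl⟩;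
      ∀ (r : LatticeRep G), ∃ βF c₁ : ℝ, ∃ S₀ : ℕ, 0 < βF ∧ βF ≤ strongCouplingRadius r.ρ ∧ 0 < c₁ ∧
        ∀ β : ℝ, 0 < β → β ≤ βF → ∀ S : ℕ, S₀ ≤ S → ∀ m : ℕ,
          (c₁ * β ^ 4) ^ (m + 2) ≤ traceExcess r.ρ β (2 * S + 1) (m + 2) := by
  intro G _ _ _ _ hG
  letI : MeasurableSpace G := borel G
  haveI : BorelSpace G := ⟨rfl⟩
  intro r
  haveI : SecondCountableTopology G :=
    (r.continuous.isClosedEmbedding r.injective).isEmbedding.secondCountableTopology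
  obtain ⟨β₀, c, C, hβ₀, hc, -, hfloor⟩ := SCFloor.facingPlaquetteCorr_floor_latticeRep G hG r
  have hr0 := strongCouplingRadius_pos r.ρ
  set rr : ℝ := strongCouplingRadius r.ρ with hrr
  set p : ℝ := max (r.N : ℝ) 1 with hpdef
  have hp : 0 < p := lt_of_lt_of_le one_pos (le_max_right _ _)
  set Cst : ℝ := 28311552 * Real.exp 28311552 with hCst
  have hCst : 0 ≤ Cst := by positivity
  -- the β-free volume floor: `Cst e^{−S/4} ≤ c r_ρ⁴/(8p²)` for `S ≥ S₀ ≥ 16`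
  obtain ⟨S₀, hS16, hS₀⟩ := exists_floor_exp_quarter_le hCst (show 0 < c * rr ^ 4 / (8 * p ^ 2) by positivity)
  refine ⟨min β₀ rr, c / (2 * p ^ 2), S₀, lt_min hβ₀ hr0, min_le_right _ _, by positivity, ?_⟩
  intro β hβpos hβF S hS m
  have hββ₀ : β ≤ β₀ := hβF.trans (min_le_left _ _)
  have hβr : β ≤ rr := hβF.trans (min_le_right _ _)
  have hSge : 16 ≤ S := hS16.trans hS
  -- the floor on the facing-plaquette covariance of the torus `(2S+1)⁴`
  have hcovL := (hfloor (2 * S + 1) (by omega) β hβpos hββ₀).1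
  rw [SCFloor.latticeConnectedCorr_plaquette_one r.ρ (2 * S + 1) β] at hcovL
  -- the thermal smallness, β-uniformly in the volume: `x ≤ Cst e^{−S/4} β⁴/r_ρ⁴ ≤ c β⁴/(8p²)`
  have hx : ∀ m' : ℕ, 2 * S + 1 ≤ m' + 3 → traceExcess r.ρ β (2 * S + 1) (m' + 2) ≤ c * β ^ 4 / (8 * p ^ 2) := by
    intro m' hm'
    have h1 := traceExcess_thermal_le_pow_four r hβpos hβr hSge (m := m') (by omega)
    refine h1.trans ?_
    have h2 := mul_le_mul_of_nonneg_right (hS₀ S hS) (show 0 ≤ β ^ 4 / rr ^ 4 by positivity)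
    refine h2.trans (le_of_eq ?_)
    field_simp
  have hbudget : 8 * (max (r.N : ℝ) 1) ^ 2 * (c * β ^ 4 / (8 * p ^ 2)) ≤ c * β ^ 4 := by
    rw [← hpdef]
    have : 8 * p ^ 2 * (c * β ^ 4 / (8 * p ^ 2)) = c * β ^ 4 := by field_simp
    rw [this]
  have hmain := traceExcess_floor_of_facingCov r hβpos.le (2 * S + 1) (by omega) hcovL hx hbudget m
  rw [← hpdef] at hmain
  have he : c / (2 * p ^ 2) * β ^ 4 = c * β ^ 4 / (2 * p ^ 2) := by ring
  rw [he]
  exact hmain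

/-! ## §3 The rung MONO-sc on ALL of `(0, β_D]` — PROVED -/

/-- **Rung MONO-sc — PROVED AS TYPED** (`VolumeMonotoneStrongCoupling`, the skeleton's `stub_rung_monoStrongCoupling`): for every compact simple
simply-connected `G` and `r : LatticeRep G` there are `β_D > 0`, ONE `θ ∈ (0, 1]`, ONE `K ≥ 1` and ONE volume floor `S₀` such that for all
`0 < β ≤ β_D`, `S₀ ≤ S ≤ S'`, `g > 0`, `C₀ ≥ 1`: `ColdPressureBound r.ρ β S g C₀ → ColdPressureBound r.ρ β S' (θ g) (K C₀)`.  Route: the floor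
`(c₁β⁴)^{m+2} ≤ traceExcess` at size `S` caps the rate, `g ≤ log(1/(c₁β⁴)) = 4 log(β_D/β) + D` (`D = log(1/(c₁β_D⁴)) ≥ log 2`); the rate-tracking
bound certifies `(1 + log(r_ρ/β))/8 ≥ (1 + log(β_D/β))/8 ≥ θ·(4 log(β_D/β) + D)` on EVERY torus with `θ = min(1/D, 1/4)/8`; rate and constant
monotonicity conclude with `K = max 1 C_st`. -/
theorem volumeMonotoneStrongCoupling_holds : VolumeMonotoneStrongCoupling := by
  intro G _ _ _ _ hG _hsc
  letI : MeasurableSpace G := borel G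
  haveI : BorelSpace G := ⟨rfl⟩
  intro r
  haveI : SecondCountableTopology G :=
    (r.continuous.isClosedEmbedding r.injective).isEmbedding.secondCountableTopology
  obtain ⟨βF, c₁, S₀, hβF, hβFr, hc₁, hfl⟩ := traceExcess_floor_strongCoupling_uniform G hG r
  have hr0 := strongCouplingRadius_pos r.ρ
  set rr : ℝ := strongCouplingRadius r.ρ with hrr
  -- `β_D := min βF √√(1/(2c₁))`, so that `c₁ β_D⁴ ≤ 1/2`
  set b₀ : ℝ := Real.sqrt (Real.sqrt (1 / (2 * c₁))) with hb₀
  have hb₀pos : 0 < b₀ := Real.sqrt_pos.2 (Real.sqrt_pos.2 (by positivity))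
  have hb₀4 : b₀ ^ 4 = 1 / (2 * c₁) := by
    rw [show b₀ ^ 4 = (b₀ ^ 2) ^ 2 by ring, hb₀, Real.sq_sqrt (Real.sqrt_nonneg _), Real.sq_sqrt (by positivity)]
  set βD : ℝ := min βF b₀ with hβD
  have hβDpos : 0 < βD := lt_min hβF hb₀pos
  have hβDF : βD ≤ βF := min_le_left _ _
  have hβDr : βD ≤ rr := hβDF.trans hβFr
  have hcD : c₁ * βD ^ 4 ≤ 1 / 2 := by
    have h1 : βD ^ 4 ≤ b₀ ^ 4 := pow_le_pow_left₀ hβDpos.le (min_le_right _ _) 4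
    calc c₁ * βD ^ 4 ≤ c₁ * b₀ ^ 4 := mul_le_mul_of_nonneg_left h1 hc₁.le
      _ = 1 / 2 := by rw [hb₀4]; field_simp
  have hcDpos : 0 < c₁ * βD ^ 4 := by positivity
  -- `D := log(1/(c₁β_D⁴)) ≥ log 2 > 0`
  set D : ℝ := -Real.log (c₁ * βD ^ 4) with hDdef
  have hD : 0 < D := by
    rw [hDdef, neg_pos]
    exact Real.log_neg hcDpos (by linarith)
  set Cst : ℝ := 28311552 * Real.exp 28311552 with hCst
  have hCst0 : 0 ≤ Cst := by positivity
  set θ : ℝ := min (1 / D) (1 / 4) / 8 with hθ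
  have hθpos : 0 < θ := by positivity
  have hθ1 : θ ≤ 1 := by
    have : min (1 / D) (1 / 4) ≤ 1 / 4 := min_le_right _ _
    rw [hθ]; linarith
  refine ⟨βD, hβDpos, θ, hθpos, hθ1, max 1 Cst, le_max_left _ _, S₀, ?_⟩
  intro β hβ hβD' S S' hS hSS' g C₀ hg hC₀ hcp
  have hβF' : β ≤ βF := hβD'.trans hβDF
  have hβr : β ≤ rr := hβD'.trans hβDr
  have hq0 : 0 < c₁ * β ^ 4 := by positivity
  -- Step 1: the floor caps the admissible rate, `g ≤ Mβ = log(1/(c₁β⁴))`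
  set Mβ : ℝ := -Real.log (c₁ * β ^ 4) with hMβ
  have hgM : g ≤ Mβ := by
    refine rate_le_of_traceExcessFloor (t₀ := 0) hcp hC₀ fun m _ => ?_
    have hexp : Real.exp (-(Mβ * ((m + 2 : ℕ) : ℝ))) = (c₁ * β ^ 4) ^ (m + 2) := by
      rw [hMβ, show -(-Real.log (c₁ * β ^ 4) * ((m + 2 : ℕ) : ℝ)) = ((m + 2 : ℕ) : ℝ) * Real.log (c₁ * β ^ 4) by ring,
        Real.exp_nat_mul, Real.exp_log hq0]
    rw [hexp]
    exact hfl β hβ hβF' S hS m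
  -- Step 2: `Mβ = 4u + D`, `u = log(β_D/β) ≥ 0`, and the certified rate `(1 + log(r_ρ/β))/8 ≥ (1 + u)/8 ≥ θ Mβ`
  set u : ℝ := Real.log (βD / β) with hu
  have hu0 : 0 ≤ u := Real.log_nonneg (by rw [le_div_iff₀ hβ, one_mul]; exact hβD')
  have hMu : Mβ = 4 * u + D := by
    rw [hMβ, hDdef, hu, Real.log_div hβDpos.ne' hβ.ne', Real.log_mul hc₁.ne' (pow_ne_zero _ hβ.ne'),
      Real.log_mul hc₁.ne' (pow_ne_zero _ hβDpos.ne'), Real.log_pow, Real.log_pow]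
    push_cast
    ring
  have hga : (1 + u) / 8 ≤ (1 + Real.log (rr / β)) / 8 := by
    have : u ≤ Real.log (rr / β) := by
      rw [hu]
      exact Real.log_le_log (div_pos hβDpos hβ) (div_le_div_of_nonneg_right hβDr hβ.le)
    linarith
  have hθM : θ * Mβ ≤ (1 + u) / 8 := by
    rw [hMu, hθ]
    have h1 : min (1 / D) (1 / 4) * (4 * u) ≤ u := by
      have : min (1 / D) (1 / 4) ≤ 1 / 4 := min_le_right _ _
      nlinarith
    have h2 : min (1 / D) (1 / 4) * D ≤ 1 := by
      have : min (1 / D) (1 / 4) ≤ 1 / D := min_le_left _ _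
      calc min (1 / D) (1 / 4) * D ≤ 1 / D * D := mul_le_mul_of_nonneg_right this hD.le
        _ = 1 := by field_simp
    nlinarith
  have hrate : θ * g ≤ (1 + Real.log (rr / β)) / 8 :=
    le_trans (mul_le_mul_of_nonneg_left hgM hθpos.le) (hθM.trans hga)
  -- Step 3: the rate-tracking bound on the LARGER torus, then rate and constant monotonicity
  have hSC : ColdPressureBound r.ρ β S' ((1 + Real.log (rr / β)) / 8) Cst := coldPressureBound_strongCoupling_log r hβ hβr S'
  have hmono : ColdPressureBound r.ρ β S' (θ * g) Cst := by
    intro m hm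
    refine (hSC m hm).trans ?_
    have hV : 0 ≤ Cst * ((2 * S' + 1 : ℕ) : ℝ) ^ 3 := by positivity
    refine mul_le_mul_of_nonneg_left (Real.exp_le_exp.2 ?_) hV
    have hm0 : (0 : ℝ) ≤ ((m + 2 : ℕ) : ℝ) := Nat.cast_nonneg _
    nlinarith
  have hconst : Cst ≤ max 1 Cst * C₀ := by
    have h1 : Cst ≤ max 1 Cst := le_max_right _ _
    have h2 : max 1 Cst ≤ max 1 Cst * C₀ := le_mul_of_one_le_right (le_trans zero_le_one (le_max_left _ _)) hC₀
    exact h1.trans h2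
  exact coldPressureBound_mono_const hmono hconst

/-! ## §4 The strong-coupling glueball window, two-sided and volume-uniform (corollary for the census) -/

/-- **Two-sided, volume-uniform control of the torus transfer gap at strong coupling.**  For every compact simple Lie group `G` and
`r : LatticeRep G` there are `0 < βF ≤ r_ρ`, `c₁ > 0` and a volume floor `S₀` such that for all `β ∈ (0, βF]`, `S ≥ S₀` and every cold time
`m + 2` with `S + 1 ≤ 2(m+2)`:
`(c₁β⁴)^{m+2} ≤ traceExcess r.ρ β (2S+1) (m+2) ≤ C_st · e^{−(1 + log(r_ρ/β))(m+2)/8}`,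
i.e. the second transfer eigenvalue of Lüscher's transfer matrix of EVERY large spatial torus satisfies
`4 log(1/β) + log(1/c₁) ≥ −log(λ₁/λ₀) =: m(β, S)` and the thermal multiplicity decays at rate `≥ (1 + log(r_ρ/β))/8`: the lattice glueball mass
is FINITE and of order `log(1/β)` on both sides, uniformly in the volume (floor: part 2b ∕ §2; ceiling: the rate-tracking bound (a)). -/
theorem traceExcess_twoSided_strongCoupling :
    ∀ (G : Type) [Group G] [TopologicalSpace G] [IsTopologicalGroup G] [CompactSpace G],
      IsCompactSimpleLieGroup G →
      letI : MeasurableSpace G := borel G; haveI : BorelSpace G := ⟨rfl⟩;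
      ∀ (r : LatticeRep G), ∃ βF c₁ : ℝ, ∃ S₀ : ℕ, 0 < βF ∧ βF ≤ strongCouplingRadius r.ρ ∧ 0 < c₁ ∧
        ∀ β : ℝ, 0 < β → β ≤ βF → ∀ S : ℕ, S₀ ≤ S → ∀ m : ℕ, S + 1 ≤ 2 * (m + 2) →
          (c₁ * β ^ 4) ^ (m + 2) ≤ traceExcess r.ρ β (2 * S + 1) (m + 2) ∧
            traceExcess r.ρ β (2 * S + 1) (m + 2) ≤
              28311552 * Real.exp 28311552 *
                Real.exp (-((1 + Real.log (strongCouplingRadius r.ρ / β)) / 8 * ((m + 2 : ℕ) : ℝ))) := by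
  intro G _ _ _ _ hG
  letI : MeasurableSpace G := borel G
  haveI : BorelSpace G := ⟨rfl⟩
  intro r
  obtain ⟨βF, c₁, S₀, hβF, hβFr, hc₁, hfl⟩ := traceExcess_floor_strongCoupling_uniform G hG r
  refine ⟨βF, c₁, S₀, hβF, hβFr, hc₁, fun β hβ hβF' S hS m hm => ⟨hfl β hβ hβF' S hS m, ?_⟩⟩
  exact coldTraceBound_strongCoupling_log r hβ (hβF'.trans hβFr) S m hm

end Summit.QuantumFields.YangMills.Cruxes.IR.VolumeMonotone

end
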